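import Literature.AlgebraicGeometry.HodgeTheory.UnitaryTwoTwoSlotsHodgeClassesInvariance
import HarnessLib

/-!
# Codimension-two Hodge classes on abelian varieties with slots over a fourfold of unitary type `(2,2)`:
# divisor classes plus (generalised) Weil classes

Topic `Literature/AlgebraicGeometry/HodgeTheory`; sequel of `UnitaryTwoTwoSlotsHodgeClassesInvariance` (the
invariance theorem at signature `(2,2)`: the slices of the coefficient function of a Hodge class are killed by the
typed differentials of every traceless `X ∈ 𝔰𝔩₄(ℂ)`) and of `ClassicalInvariants/MixedTensorLieInvariantsSL` (§4:
balanced slices are `𝔤𝔩`-invariant, slices with `4 ∤ #vec − #cov` vanish; §5: slices on four vector positions are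
multiples of the determinant tensor). Written for the cell `pub-hodge-ring2` (HONEST FRAMING of that cell: research
route conditional on HC_CM; not a corollary; Q11.4-sentence-2 already refuted in dim ≥ 3), Literature lane gen 68,
heir item (H1a) of Moonen–Zarhin 1995 row four «type IV(1,1), signature (2,2)» IN CODIMENSION TWO. Theorems only
(no definition, no named fact, D-0026), no `sorry`.

WHAT IS PROVED: **`AVSlots.codimTwoHodgeClasses_divisorWeil_twoTwo`** — for an abelian variety `B` with slots
`g : Fin n → (B ⟶ A)` over an abelian variety `A` whose `H¹` carries `φ` with `φ² = −d`, `End_Hdg = ℚ + ℚφ` and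
multiplicities `(2,2)` on `W = ker(φ_ℂ − μ)` (so `dim A = 4`), with an adapted dual basis `cb` of `H¹(A,ℂ) = W ⊕ W'`
and the crossed classes of two slots in `B¹(B) ⊗ ℂ` (`hcross`, as in the `(2,3)` assembly), every rational
`(2,2)`-class on `B` lies in
`D²(B) ⊗ ℂ + Σ_{j : Fin 4 → Fin n} ℂ·Ω_W(j) + Σ_j ℂ·Ω_{W'}(j)`, where
`Ω_W(j) := Σ_{σ ∈ 𝔖₄} sgn(σ) · (g_{j 0}^* e_{σ 0} ⌣ g_{j 1}^* e_{σ 1} ⌣ g_{j 2}^* e_{σ 2} ⌣ g_{j 3}^* e_{σ 3})`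
(`e_ℓ = cb (0,ℓ)` the `W`-letters; `Ω_{W'}` the same with the `W'`-letters `cb (1,ℓ)`) are the (generalised) WEIL
CLASSES: for `B = A` (one slot) `Ω_W = 4!·e₀ ⌣ e₁ ⌣ e₂ ⌣ e₃ = 4!·ω_W ∈ ⋀⁴_K H¹(A,K) ⊗ ℂ`. In words: in codimension
two the Hodge ring of `B` is generated by divisor classes and Weil-type classes — Moonen–Zarhin's theorem for this
row («`B• = ⟨D, W_K⟩`», MZ95) read in codimension 2, and van Geemen's Thm. 6.12 («`B² = B¹·B¹ ⊕ W_K`, `dim B² = 19`»)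
for the general fourfold with `K ⊂ End`, here for ALL `B` with slots over `A` (all powers of `A`, products with
factors of `A`, …) and WITHOUT the tensor first fundamental theorem for `SL₄` — only the three elementary facts of
`MixedTensorLieInvariantsSL` §4–§5 and the `GL` pipeline of the tree are used.

§2 **`AVSlots.codimTwoHodgeClasses_divisorWeil_of_unitaryTwoTwo`** — the same with GEOMETRIC hypotheses only
(`φ ≫ φ = −d`, `finrank_ℚ End⁰(A) = 2`, `dim A = 4`, both multiplicities of `φ` at least `2`): the letters are an
adapted dual basis of `φ^*`-eigenclasses, produced as in `AVSlots.isDivisorGenerated_of_ribetTypeTwoThree`.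

PROOF. `AVSlots.exists_unitaryInvariant_coeff_twoTwo` writes the class as `∑_U ∑_ε a_U(ε)·F(y(U,ε))` over
slot-and-type assignments `U : Fin 4 → Fin n × Fin 2` with every slice `a_U` killed by the traceless typed
differentials. Split by the type count of `U`: (2,2) — the slice is `𝔤𝔩₄`-invariant
(`wordDerAt_mixedLieFamily_eq_zero_of_forall_trace_of_card_eq`), hence a combination of complete contractions (tensor
FFT for `GL`), each evaluating to `±` a product of crossed classes (Milne Prop. 3.6 (c), verbatim the `(2,3)`
assembly) — in `D²`; (3,1)/(1,3) — the slice vanishes (`eq_zero_of_forall_trace_of_not_dvd`, `4 ∤ ±2`); (4,0)/(0,4)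
— the slice is `a_U(id)·sgn` on permutation words and `0` elsewhere (`apply_perm_eq_sign_mul_of_forall_trace`,
`apply_eq_zero_of_forall_trace_of_not_bijective`), so the `U`-term is `a_U(id)·Ω_W(j_U)` resp. `a_U(id)·Ω_{W'}(j_U)`.

## References
* [MoonenZarhin1995Duke] B. Moonen, Yu. Zarhin, Hodge classes and Tate classes on simple abelian fourfolds, Duke
  Math. J. 77 (1995) 553–581, main theorem, row «type IV(1,1), (2,2)»: `B• = ⟨D, W_K⟩` (cite-only, acq-04933).
* [vanGeemen1994HodgeAV] B. van Geemen, An introduction to the Hodge conjecture for abelian varieties, LNM 1594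
  (1994), Thm. 6.12 (`B² = B¹·B¹ ⊕ W_K`), Lemma 5.4 (`𝔪𝔱 = 𝔲(2,2)`, `𝔥𝔤 ⊂ 𝔰𝔲(2,2)`).
* [MoonenZarhin1999LowDim] B. Moonen, Yu. Zarhin, Hodge classes on abelian varieties of low dimension, Math. Ann.
  315 (1999), §2 (2.5) (2).
* [Milne1999LefschetzClasses] J. S. Milne, Lefschetz classes on abelian varieties, Duke Math. J. 96 (1999),
  Prop. 3.6 (c).
* [GoodmanWallachGTM255] R. Goodman, N. R. Wallach, Symmetry, Representations, and Invariants, GTM 255 (2009),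
  Thm. 2.2.2, Thm. 2.2.7 (2), §5.3.1, Thm. 5.3.1.
-/

noncomputable section

open scoped TensorProduct
open scoped Matrix
open CategoryTheory Module

namespace Literature.AlgebraicGeometry.HodgeTheory

open Literature.AlgebraicTopology.SingularHomology
open Literature.AlgebraicGeometry.Motives (IsSmoothProjective AbelianVariety bettiCohomology
  ofRatClassBaseChange HodgeTensorFacts hodgeTensorFacts_holds)
open Literature.AlgebraicGeometry.ComplexMultiplication (bettiRep_of)
open Literature.Barriers.HodgeConjecture
open Literature.AlgebraicGeometry.Motives.HodgeStructure
open Literature.RepresentationTheory.GeneralLinear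
open Literature.RepresentationTheory.ClassicalInvariants
open Literature.NumberTheory.DiophantineGeometry

/-- The two elements of `Fin 2` (local copy). [folklore] -/
private theorem fin2_cases'' (t : Fin 2) : t = 0 ∨ t = 1 := by
  rcases t with ⟨_ | _ | k, hk⟩
  · exact Or.inl rfl
  · exact Or.inr rfl
  · omega

/-- A sum over all words `Fin m → Fin m` of a function vanishing off the bijective words is the sum over the
permutations. [folklore] -/
private theorem sum_eq_sum_perm {M : Type*} [AddCommMonoid M] {m : ℕ} (f : (Fin m → Fin m) → M)
    (hf : ∀ w, ¬ Function.Bijective w → f w = 0) :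
    ∑ w : Fin m → Fin m, f w = ∑ σ : Equiv.Perm (Fin m), f ⇑σ := by
  classical
  let emb : Equiv.Perm (Fin m) ↪ (Fin m → Fin m) := ⟨fun σ => ⇑σ, Equiv.coe_fn_injective⟩
  change ∑ w, f w = ∑ σ, f (emb σ)
  rw [← Finset.sum_map Finset.univ emb f]
  refine (Finset.sum_subset (Finset.subset_univ _) fun w _ hw => hf w fun hb => hw ?_).symm
  exact Finset.mem_map.2 ⟨Equiv.ofBijective w hb, Finset.mem_univ _, rfl⟩

variable {A B : AbelianVariety ℂ} {n : ℕ} {g : Fin n → (B ⟶ A)}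

open scoped Classical in
/-- **Codimension-two Hodge classes on `B` with slots over a fourfold of unitary type `(2,2)` are divisor classes
plus generalised Weil classes.** Data as in `AVSlots.exists_unitaryInvariant_coeff_twoTwo` with `n₀ = 4` letters,
plus `hcross` (the crossed classes `∑_ℓ g_j^* e_ℓ ⌣ g_{j'}^* f_ℓ` of two slots lie in `B¹(B) ⊗ ℂ`). Conclusion: every
rational `(2,2)`-class on `B` lies in `D²(B) ⊗ ℂ ⊔ span{Ω_t(j) : j : Fin 4 → Fin n, t : Fin 2}`,
`Ω_t(j) = Σ_{σ ∈ 𝔖₄} sgn σ · F(q ↦ g_{j q}^* cb(t, σ q))` (`F` the alternating 4-fold cup product) — the Weil-type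
classes built from the `W`-letters (`t = 0`) resp. the `W'`-letters (`t = 1`). Moonen–Zarhin 1995, row
«IV(1,1), (2,2)»: `B• = ⟨D, W_K⟩`, here in codimension 2 and for all `B` with slots over `A`; van Geemen Thm. 6.12.
[cite: MoonenZarhin1995Duke, main theorem (type IV(1,1), (2,2))] [cite: vanGeemen1994HodgeAV, Thm. 6.12 and Lemma 5.4]
[cite: MoonenZarhin1999LowDim, §2 (2.5) (2)] [cite: Milne1999LefschetzClasses, Prop. 3.6 (c)]
[cite: GoodmanWallachGTM255, Thm. 2.2.2, §5.3.1 and Thm. 5.3.1] -/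
theorem AVSlots.codimTwoHodgeClasses_divisorWeil_twoTwo [HodgeTensorFacts.{0, 0}] (hg : AVSlots A B g)
    (hHD : exists_isReal_hodgeModel) (hI : hodgePQ_independent_of_hodgeModel)
    (ψ : (BettiUniverse.hodge hHD (AbelianVariety.isSmoothProjective_holds (A := A)) 1).Polarization)
    {φ : Module.End ℚ (bettiCohomology A.X 1)}
    (hφE : φ ∈ (BettiUniverse.hodge hHD (AbelianVariety.isSmoothProjective_holds (A := A)) 1).endAlg)
    {d : ℚ} (hd : 0 < d) (hφ2 : φ * φ = -(d • 1))
    (hE : ∀ a ∈ (BettiUniverse.hodge hHD (AbelianVariety.isSmoothProjective_holds (A := A)) 1).endAlg,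
      ∃ x y : ℚ, a = x • 1 + y • φ)
    {μ : ℂ} (hμ : μ ^ 2 = -(d : ℂ))
    (h22 : Module.finrank ℂ ↥(Module.End.eigenspace (φ.baseChange ℂ) μ ⊓
        (BettiUniverse.hodge hHD (AbelianVariety.isSmoothProjective_holds (A := A)) 1).piece 1 0) = 2 ∧
      Module.finrank ℂ ↥(Module.End.eigenspace (φ.baseChange ℂ) μ ⊓
        (BettiUniverse.hodge hHD (AbelianVariety.isSmoothProjective_holds (A := A)) 1).piece 0 1) = 2)
    (cb : Module.Basis (Fin 2 × Fin 4) ℂ (ℂ ⊗[ℚ] bettiCohomology A.X 1)) (κ : Fin 4 → Fin 2)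
    (hcbW : ∀ ℓ, cb (0, ℓ) ∈ Module.End.eigenspace (φ.baseChange ℂ) μ)
    (hcbW' : ∀ ℓ, cb (1, ℓ) ∈ Module.End.eigenspace (φ.baseChange ℂ) (-μ))
    (hcb0 : ∀ ℓ, κ ℓ = 0 →
      cb (0, ℓ) ∈ (BettiUniverse.hodge hHD (AbelianVariety.isSmoothProjective_holds (A := A)) 1).piece 1 0 ∧
      cb (1, ℓ) ∈ (BettiUniverse.hodge hHD (AbelianVariety.isSmoothProjective_holds (A := A)) 1).piece 0 1)
    (hcb1 : ∀ ℓ, κ ℓ = 1 →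
      cb (0, ℓ) ∈ (BettiUniverse.hodge hHD (AbelianVariety.isSmoothProjective_holds (A := A)) 1).piece 0 1 ∧
      cb (1, ℓ) ∈ (BettiUniverse.hodge hHD (AbelianVariety.isSmoothProjective_holds (A := A)) 1).piece 1 0)
    (hdual : ∀ i j, ψ.form.baseChange ℂ (cb (0, i)) (cb (1, j)) = if i = j then 1 else 0)
    (hcross : ∀ j j' : Fin n,
      (∑ ℓ : Fin 4, cupProduct (rfl : 1 + 1 = 2)
          (avLetters g (fun tl : Fin 2 × Fin 4 => ofRatClassBaseChange (Motives.ComplexPoints A.X) 1 (cb tl))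
            (j, ((0 : Fin 2), ℓ)))
          (avLetters g (fun tl : Fin 2 × Fin 4 => ofRatClassBaseChange (Motives.ComplexPoints A.X) 1 (cb tl))
            (j', ((1 : Fin 2), ℓ)))) ∈
        Submodule.span ℂ {b : complexBetti B.X 2 | IsRationalClass b ∧ IsOfHodgeType B.dim B.X 2 1 1 b})
    {c : complexBetti B.X (2 * 2)} (hcQ : IsRationalClass c) (hc : IsOfHodgeType B.dim B.X (2 * 2) 2 2 c) :
    c ∈ divisorClassesSpan B.X B.dim 2 ⊔
      Submodule.span ℂ (Set.range fun jt : (Fin (2 * 2) → Fin n) × Fin 2 =>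
        ∑ σ : Equiv.Perm (Fin (2 * 2)), ((Equiv.Perm.sign σ : ℤ) : ℂ) •
          cupPowOneAlt ℂ (Motives.ComplexPoints B.X) (2 * 2) (fun q =>
            avLetters g (fun tl : Fin 2 × Fin 4 => ofRatClassBaseChange (Motives.ComplexPoints A.X) 1 (cb tl))
              (jt.1 q, (jt.2, σ q)))) := by
  classical
  obtain ⟨a, hca, hkill⟩ := hg.exists_unitaryInvariant_coeff_twoTwo hHD hI ψ hφE hd hφ2 hE hμ h22 cb κ hcbW hcbW'
    hcb0 hcb1 hdual (p := 2) two_pos hcQ hc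
  set y : (Fin n × Fin 2) × Fin 4 → complexBetti B.X 1 := fun x =>
    avLetters g (fun tl : Fin 2 × Fin 4 => ofRatClassBaseChange (Motives.ComplexPoints A.X) 1 (cb tl))
      (x.1.1, (x.1.2, x.2)) with hy
  set F := cupPowOneAlt ℂ (Motives.ComplexPoints B.X) (2 * 2) with hFdef
  rw [← hca, wordEval_eq_sum_wordSlice]
  refine Submodule.sum_mem _ fun U _ => ?_
  set ty : Fin (2 * 2) → Bool := fun t => decide ((U t).2 = 0) with hty
  have hkillU : ∀ X : Matrix (Fin 4) (Fin 4) ℂ, X.trace = 0 →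
      wordDerAt ℂ (mixedLieFamily ty X) (wordSlice a U) = 0 := by
    intro X hX
    have hfam : mixedLieFamily ty X = fun t => if (U t).2 = 0 then X else -Xᵀ := by
      funext t
      simp only [hty, mixedLieFamily, decide_eq_true_eq]
    rw [hfam]
    exact hkill U X hX
  by_cases hbal : (Finset.univ.filter fun t => ty t = true).card = (Finset.univ.filter fun t => ty t = false).card
  · /- (2,2)-type slices: `𝔤𝔩₄`-invariant, tensor FFT for `GL`, crossed classes — in `D²` -/
    refine Submodule.mem_sup_left ?_
    have hLie : ∀ X : Matrix (Fin 4) (Fin 4) ℂ, wordDerAt ℂ (mixedLieFamily ty X) (wordSlice a U) = 0 :=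
      wordDerAt_mixedLieFamily_eq_zero_of_forall_trace_of_card_eq ty hkillU hbal
    have hmem := mem_span_contractionTensor_of_forall_wordDerAt_mixedLieFamily_eq_zero ty hLie
    set Λ := Fintype.linearCombination ℂ (fun ε : Word 4 (2 * 2) => F (fun q => y (U q, ε q))) with hΛ
    have hΛapply : ∀ cf : Word 4 (2 * 2) → ℂ, Λ cf = ∑ ε, cf ε • F (fun q => y (U q, ε q)) :=
      fun cf => Fintype.linearCombination_apply ℂ _ cf
    rw [← hΛapply]
    refine (Submodule.span_le (p := (divisorClassesSpan B.X B.dim 2).comap Λ)).2 ?_ hmem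
    rintro _ ⟨β, -, rfl⟩
    rw [SetLike.mem_coe, Submodule.mem_comap, hΛapply]
    -- evaluation of a complete contraction: `±` a product of crossed classes
    obtain ⟨π, eP, hsum⟩ := Milne1999.sum_contractionTensor_smul_eq F ty β y U
    rw [hsum]
    refine Submodule.smul_mem _ _ ?_
    simp_rw [hFdef, cupPowOneAlt_apply]
    refine Milne1999.sum_cupPowOne_glPairWord_mem y 2 _ _ fun i => ?_
    have h0 : (U (eP.symm i : Fin (2 * 2))).2 = 0 := by
      have h := (eP.symm i).2
      simpa [hty] using h
    have h1' : (U (β (eP.symm i) : Fin (2 * 2))).2 = 1 := by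
      have h := (β (eP.symm i)).2
      simp only [hty, decide_eq_false_iff_not] at h
      rcases fin2_cases'' (U (β (eP.symm i) : Fin (2 * 2))).2 with h' | h'
      · exact absurd h' h
      · exact h'
    have hyU : ∀ (q : Fin (2 * 2)) (ℓ : Fin 4), y (U q, ℓ) = avLetters g (fun tl : Fin 2 × Fin 4 =>
        ofRatClassBaseChange (Motives.ComplexPoints A.X) 1 (cb tl)) ((U q).1, ((U q).2, ℓ)) := fun q ℓ => rfl
    simp only [hyU, h0, h1']
    exact hcross _ _
  · -- the type counts
    have hsum4 : (Finset.univ.filter fun t => ty t = true).card +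
        (Finset.univ.filter fun t => ty t = false).card = 4 := by
      have h := Finset.card_filter_add_card_filter_not (s := (Finset.univ : Finset (Fin (2 * 2))))
        (fun t => ty t = true)
      simp only [Bool.not_eq_true, Finset.card_univ, Fintype.card_fin] at h
      exact h
    by_cases hdvd : ((4 : ℕ) : ℤ) ∣ (((Finset.univ.filter fun t => ty t = true).card : ℤ) -
        ((Finset.univ.filter fun t => ty t = false).card : ℤ))
    · /- (4,0)- or (0,4)-type slices: multiples of the determinant tensor — Weil-type classes -/
      refine Submodule.mem_sup_right ?_
      obtain ⟨k, hk⟩ := hdvd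
      have hcases : (Finset.univ.filter fun t => ty t = true).card = 4 ∨
          (Finset.univ.filter fun t => ty t = false).card = 4 := by omega
      -- the common shape of the two cases
      have hshape : ∀ t₀ : Fin 2, (∀ t, (U t).2 = t₀) →
          (∀ X : Matrix (Fin 4) (Fin 4) ℂ, X.trace = 0 →
            wordDerAt ℂ (mixedLieFamily (fun _ : Fin 4 => true) X) (wordSlice a U) = 0) →
          (∑ ε : Word 4 (2 * 2), wordSlice a U ε • F (fun q => y (U q, ε q))) ∈
            Submodule.span ℂ (Set.range fun jt : (Fin (2 * 2) → Fin n) × Fin 2 =>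
              ∑ σ : Equiv.Perm (Fin (2 * 2)), ((Equiv.Perm.sign σ : ℤ) : ℂ) •
                F (fun q => avLetters g (fun tl : Fin 2 × Fin 4 =>
                  ofRatClassBaseChange (Motives.ComplexPoints A.X) 1 (cb tl)) (jt.1 q, (jt.2, σ q)))) := by
        intro t₀ hU h5
        rw [sum_eq_sum_perm (fun ε : Word 4 (2 * 2) => wordSlice a U ε • F (fun q => y (U q, ε q)))
          (fun ε hε => by rw [apply_eq_zero_of_forall_trace_of_not_bijective h5 hε, zero_smul])]
        have hterm : ∀ σ : Equiv.Perm (Fin (2 * 2)), wordSlice a U ⇑σ • F (fun q => y (U q, σ q)) =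
            wordSlice a U ⇑(1 : Equiv.Perm (Fin (2 * 2))) • (((Equiv.Perm.sign σ : ℤ) : ℂ) •
              F (fun q => avLetters g (fun tl : Fin 2 × Fin 4 =>
                ofRatClassBaseChange (Motives.ComplexPoints A.X) 1 (cb tl)) ((fun q => (U q).1) q, (t₀, σ q)))) := by
          intro σ
          rw [apply_perm_eq_sign_mul_of_forall_trace h5 σ,
            mul_comm (((Equiv.Perm.sign σ : ℤ) : ℂ)) (wordSlice a U ⇑(1 : Equiv.Perm (Fin (2 * 2)))), ← smul_smul]
          congr 3
          funext q
          rw [hy]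
          simp only [hU q]
        rw [Finset.sum_congr rfl fun σ _ => hterm σ, ← Finset.smul_sum]
        exact Submodule.smul_mem _ _ (Submodule.subset_span ⟨((fun q => (U q).1), t₀), rfl⟩)
      rcases hcases with h4 | h4
      · -- all positions of `W`-type
        have hall : ∀ t, ty t = true := by
          intro t
          have hmem : t ∈ Finset.univ.filter fun t => ty t = true := by
            rw [Finset.eq_univ_of_card (Finset.univ.filter fun t => ty t = true) (by rw [h4, Fintype.card_fin])]
            exact Finset.mem_univ t
          exact (Finset.mem_filter.1 hmem).2
        have hU : ∀ t, (U t).2 = 0 := fun t => by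
          have h := hall t
          simp only [hty, decide_eq_true_eq] at h
          exact h
        have hty' : ty = fun _ => true := funext hall
        refine hshape 0 hU fun X hX => ?_
        rw [← hty']
        exact hkillU X hX
      · -- all positions of `W'`-type
        have hall : ∀ t, ty t = false := by
          intro t
          have hmem : t ∈ Finset.univ.filter fun t => ty t = false := by
            rw [Finset.eq_univ_of_card (Finset.univ.filter fun t => ty t = false) (by rw [h4, Fintype.card_fin])]
            exact Finset.mem_univ t
          exact (Finset.mem_filter.1 hmem).2
        have hU : ∀ t, (U t).2 = 1 := fun t => by
          have h := hall t
          simp only [hty, decide_eq_false_iff_not] at h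
          rcases fin2_cases'' (U t).2 with h0 | h1
          · exact absurd h0 h
          · exact h1
        have hty' : ty = fun _ => false := funext hall
        refine hshape 1 hU fun X hX => ?_
        have hX' : (-Xᵀ).trace = 0 := by rw [Matrix.trace_neg, Matrix.trace_transpose, hX, neg_zero]
        have hfam : mixedLieFamily (fun _ : Fin (2 * 2) => true) X = mixedLieFamily ty (-Xᵀ) := by
          funext t
          rw [mixedLieFamily_of_eq_true _ rfl, hty', mixedLieFamily_of_eq_false _ rfl, Matrix.transpose_neg,
            Matrix.transpose_transpose, neg_neg]
        rw [hfam]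
        exact hkillU _ hX'
    · /- (3,1)- or (1,3)-type slices vanish -/
      rw [eq_zero_of_forall_trace_of_not_dvd ty hkillU hdvd]
      simp only [Pi.zero_apply, zero_smul, Finset.sum_const_zero]
      exact Submodule.zero_mem _

/-! ### §2 The geometric form: abelian varieties with slots over a fourfold of unitary type `(2,2)` -/

/-- **Codimension-two Hodge classes on `B` with slots over an abelian FOURFOLD `A` of unitary type `(2,2)` are
divisor classes plus generalised Weil classes — geometric hypotheses only.** Hypotheses: `φ ≫ φ = −d` (`d > 0`),
`finrank_ℚ End⁰(A) = 2`, `dim A = 4`, both multiplicities of `φ` (at `± i√d`) at least `2` (hence `(2,2)`).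
Conclusion: there are letters `L : Fin 2 × Fin 4 → H¹(A,ℂ)` — `L(0,·)` in the `i√d`-eigenspace `W` of `φ^*`,
`L(1,·)` in the `−i√d`-eigenspace `W'` (an adapted dual basis) — such that every rational `(2,2)`-class on `B` lies
in `D²(B) ⊗ ℂ ⊔ span{Σ_σ sgn σ · F(q ↦ g_{j q}^* L(t, σ q))}` (the Weil-type classes of the `W`- resp. `W'`-letters).
Assembled exactly as `AVSlots.isDivisorGenerated_of_ribetTypeTwoThree` (polarization, `φ^*_ℚ`, multiplicities,
`UnitaryTheta.exists_adaptedDualBasis`, crossed classes are divisor classes) from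
`AVSlots.codimTwoHodgeClasses_divisorWeil_twoTwo`. Moonen–Zarhin 1995 row «IV(1,1), (2,2)» (`B• = ⟨D, W_K⟩`) in
codimension 2; van Geemen Thm. 6.12. [cite: MoonenZarhin1995Duke, main theorem (type IV(1,1), (2,2))]
[cite: vanGeemen1994HodgeAV, Thm. 6.12 and Lemma 5.4] [cite: MoonenZarhin1999LowDim, §2 (2.4) and (2.5) (2)]
[cite: Milne1999LefschetzClasses, Prop. 3.3 and Prop. 3.6 (c)] -/
theorem AVSlots.codimTwoHodgeClasses_divisorWeil_of_unitaryTwoTwo (hg : AVSlots A B g) (φ : A ⟶ A) {d : ℕ}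
    (hd : 0 < d) (hφ : φ ≫ φ = -(d • 𝟙 A)) (hE2 : Module.finrank ℚ A.endAlgebra = 2)
    (h2a : 2 ≤ eigenMultiplicity A φ (Complex.I * (Real.sqrt d : ℂ)))
    (h2b : 2 ≤ eigenMultiplicity A φ (-(Complex.I * (Real.sqrt d : ℂ)))) (hdim : A.dim = 4)
    {c : complexBetti B.X (2 * 2)} (hcQ : IsRationalClass c) (hc : IsOfHodgeType B.dim B.X (2 * 2) 2 2 c) :
    ∃ L : Fin 2 × Fin 4 → complexBetti A.X 1,
      (∀ ℓ, VanGeemen1994.pullbackOne A φ (L (0, ℓ)) = (Complex.I * (Real.sqrt d : ℂ)) • L (0, ℓ)) ∧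
      (∀ ℓ, VanGeemen1994.pullbackOne A φ (L (1, ℓ)) = (-(Complex.I * (Real.sqrt d : ℂ))) • L (1, ℓ)) ∧
      c ∈ divisorClassesSpan B.X B.dim 2 ⊔
        Submodule.span ℂ (Set.range fun jt : (Fin (2 * 2) → Fin n) × Fin 2 =>
          ∑ σ : Equiv.Perm (Fin (2 * 2)), ((Equiv.Perm.sign σ : ℤ) : ℂ) •
            cupPowOneAlt ℂ (Motives.ComplexPoints B.X) (2 * 2) (fun q => avLetters g L (jt.1 q, (jt.2, σ q)))) := by
  classical
  have hHD : exists_isReal_hodgeModel := exists_isReal_hodgeModel_holds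
  have hI : hodgePQ_independent_of_hodgeModel := hodgePQ_independent_of_hodgeModel_holds
  haveI : HodgeTensorFacts.{0, 0} := hodgeTensorFacts_holds.{0, 0}
  haveI : Module.Finite ℚ (bettiCohomology A.X 1) := finite_bettiCohomology_one A
  have hX : IsSmoothProjective A.dim A.X := AbelianVariety.isSmoothProjective_holds
  -- a polarization of `H¹(A(ℂ); ℚ)`
  obtain ⟨ψ⟩ : (BettiUniverse.hodge hHD (AbelianVariety.isSmoothProjective_holds (A := A)) 1).IsPolarizable :=
    smoothProjective_hodgeStructure_isPolarizable_holds hX (BettiUniverse.realHodgeModel hHD hX)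
      (BettiUniverse.realHodgeModel_isHodgeSymmetric hHD hX) 1
  have heff := BettiUniverse.hodge_isEffective hHD hX 1
  -- the rational datum `φ^*_ℚ`
  set φQ : Module.End ℚ (bettiCohomology A.X 1) := (bettiCohomology.map φ.hom.hom.hom 1).hom with hφQ
  have hφE : φQ ∈ (BettiUniverse.hodge hHD (AbelianVariety.isSmoothProjective_holds (A := A)) 1).endAlg := by
    have h := unop_bettiRep_mem_endAlg hHD hI (AbelianVariety.endAlgebra.of A φ)
    rwa [bettiRep_of, MulOpposite.unop_op] at h
  have hφ2 : φQ * φQ = -((d : ℚ) • 1) := bettiMapHom_mul_self hφ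
  have hdQ : (0 : ℚ) < d := Nat.cast_pos.2 hd
  have hE := exists_eq_smul_one_add_smul_bettiMapHom hHD hI hd hφ hE2 (by omega)
  -- the eigenvalue `μ = i√d` and the multiplicities `(2, 2)`
  have hsum := eigenMultiplicity_add_eigenMultiplicity_neg_eq_dim A φ hd hφ
  set μ : ℂ := Complex.I * (Real.sqrt d : ℂ) with hμdef
  have hμ : μ ^ 2 = -((d : ℚ) : ℂ) := by
    rw [hμdef, mul_pow, Complex.I_sq, ← Complex.ofReal_pow, Real.sq_sqrt (Nat.cast_nonneg d),
      Complex.ofReal_natCast, Rat.cast_natCast, neg_one_mul]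
  have hconj : starRingEnd ℂ μ = -μ := by
    rw [hμdef, map_mul, Complex.conj_I, Complex.conj_ofReal, neg_mul]
  have h22 : Module.finrank ℂ ↥(Module.End.eigenspace (φQ.baseChange ℂ) μ ⊓
        (BettiUniverse.hodge hHD (AbelianVariety.isSmoothProjective_holds (A := A)) 1).piece 1 0) = 2 ∧
      Module.finrank ℂ ↥(Module.End.eigenspace (φQ.baseChange ℂ) μ ⊓
        (BettiUniverse.hodge hHD (AbelianVariety.isSmoothProjective_holds (A := A)) 1).piece 0 1) = 2 := by
    rw [hφQ, finrank_eigenspace_inf_piece_oneZero_eq_eigenMultiplicity hHD hI φ μ,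
      finrank_eigenspace_inf_piece_zeroOne_eq_eigenMultiplicity_conj hHD hI φ μ, hconj]
    omega
  -- adapted dual bases, with `n₀ = dim A = 4` letters of each type
  obtain ⟨n₀, cb, κ, hcbW, hcbW', hcb0, hcb1, hdual⟩ := UnitaryTheta.exists_adaptedDualBasis
    (BettiUniverse.hodge hHD (AbelianVariety.isSmoothProjective_holds (A := A)) 1) Nat.cast_one heff ψ hφE
    hdQ hφ2 hE hμ
  have hn₀ : n₀ = 4 := by
    have h1 := Module.finrank_eq_card_basis cb
    rw [Module.finrank_baseChange, Fintype.card_prod, Fintype.card_fin, Fintype.card_fin,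
      Motives.AbelianVariety.finrank_bettiCohomology_one_eq_of_natCard_torsionPoints A
        (Motives.AbelianVariety.natCard_torsionPoints_of_isAlgClosed_holds A ℂ), hdim] at h1
    omega
  subst hn₀
  -- the eigen-relations of the letters
  obtain ⟨hμ0, -⟩ := UnitaryTheta.conj_eq_neg_of_sq hdQ hμ
  have hne : μ ≠ -μ := fun h => hμ0 (by
    have h2 : (2 : ℂ) * μ = 0 := by rw [two_mul]; nth_rw 2 [h]; exact add_neg_cancel μ
    exact (mul_eq_zero.1 h2).resolve_left two_ne_zero)
  have he : ∀ i, VanGeemen1994.pullbackOne A φ (ofRatClassBaseChange (Motives.ComplexPoints A.X) 1 (cb (0, i))) =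
      μ • ofRatClassBaseChange (Motives.ComplexPoints A.X) 1 (cb (0, i)) := fun i => by
    have h := congrArg (ofRatClassBaseChange (Motives.ComplexPoints A.X) 1)
      (Module.End.mem_eigenspace_iff.1 (hcbW i))
    rw [hφQ, ofRatClassBaseChange_baseChange_bettiMapHom, map_smul] at h
    exact h
  have hf : ∀ i, VanGeemen1994.pullbackOne A φ (ofRatClassBaseChange (Motives.ComplexPoints A.X) 1 (cb (1, i))) =
      (-μ) • ofRatClassBaseChange (Motives.ComplexPoints A.X) 1 (cb (1, i)) := fun i => by
    have h := congrArg (ofRatClassBaseChange (Motives.ComplexPoints A.X) 1)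
      (Module.End.mem_eigenspace_iff.1 (hcbW' i))
    rw [hφQ, ofRatClassBaseChange_baseChange_bettiMapHom, map_smul] at h
    exact h
  refine ⟨fun tl => ofRatClassBaseChange (Motives.ComplexPoints A.X) 1 (cb tl), fun ℓ => he ℓ, fun ℓ => hf ℓ, ?_⟩
  refine hg.codimTwoHodgeClasses_divisorWeil_twoTwo hHD hI ψ hφE hdQ hφ2 hE hμ h22 cb κ hcbW hcbW' hcb0 hcb1 hdual
    (fun j j' => ?_) hcQ hc
  -- the crossed classes are divisor classes
  have hθ := sum_cupH1_adaptedDualBasis_mem_span_rational_oneOne hHD hI ψ hφE hdQ hφ2 hE hμ cb κ hcbW hcbW'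
    hcb0 hcb1 hdual
  simp only [cupH1_apply] at hθ
  exact Milne1999.sum_cross_mem_span_rational_oneOne_of_eigen φ (g j) (g j')
    (fun i => ofRatClassBaseChange (Motives.ComplexPoints A.X) 1 (cb (0, i)))
    (fun i => ofRatClassBaseChange (Motives.ComplexPoints A.X) 1 (cb (1, i))) hne he hf hθ

end Literature.AlgebraicGeometry.HodgeTheory

end
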